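import Mathlib
import Literature.Analysis.FluidPDE.ClassicalSolution
import Literature.Analysis.FluidPDE.NSWave0
import Literature.Analysis.FluidPDE.LerayHopf
import Literature.Analysis.FluidPDE.LoadedSphereDynamics

/-!
# Route RotatingEulerWindowProfile — the summit-restricted case matching the BC5 rung
`rotatingEulerWindowProfile_linearRung` (tribunal T3 `s_case`)

The BC5 rung of the deciding crux `RotatingWindowProfileExists` (`Theorems/RotatingEulerWindowProfileLinearRung.lean`)
inhabits the rotated profile clause block, minus its far-field decay, by LINEAR profiles `U = A y` (infinite-energy,
stagnation-type rotating self-similar Euler blow-ups). The statement below is the route's refutation target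
`¬ NavierStokesRegularity` (¬ Clay (A)) RESTRICTED TO THAT REGIME: a zero-force Navier–Stokes (`ν > 0`) maximal smooth
solution from rapidly decaying data, singular at `T`, whose rotating self-similar zoom (exponent `β ∈ [2/5, 1/2)`, angular
speed `α ≠ 0` about a unit axis `e`, centre `c`) converges on every compact window to a linear profile `y ↦ A y` — the
same convergence clause as the route's cruxes `RotatingProfileEulerRealisation` / `EulerWindowViscousTransfer` with
`U := A`. Such a blow-up would be of Type II (`|u| ~ (T-t)^(β-1)` on the window, `β < 1/2`); no theorem in print or in
the tree proves or excludes it, so the rung's regime lies outside the summit's known regime. It is a `Prop` that is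
STATED, never asserted; the tribunal kernel only checks that its cheap portfolio cannot close it.
-/

open Literature.Analysis.FluidPDE

namespace Summit.NavierStokesRegularity.NavierStokesRegularity.Theorems

/-- Tribunal T3 `s_case` for route `RotatingEulerWindowProfile`: ¬Clay (A) realised inside the regime of the BC5 rung
`rotatingEulerWindowProfile_linearRung` — a finite-time singularity of zero-force 3D Navier–Stokes from rapidly decaying
smooth data whose rotating self-similar rescaling about `(x₀, T)` converges locally uniformly to a LINEAR profile `A`.
Open (nothing of the kind is known or excluded; Type II regime). Never assert it. -/
def LinearRotatingProfileNSBlowup : Prop :=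
  ∃ (β α : ℝ) (e c : EuclideanSpace ℝ (Fin 3)) (A : EuclideanSpace ℝ (Fin 3) →L[ℝ] EuclideanSpace ℝ (Fin 3)),
    (2 / 5 : ℝ) ≤ β ∧ β < 1 / 2 ∧ α ≠ 0 ∧ ‖e‖ = 1 ∧
    ∃ (ν T : ℝ) (x₀ : EuclideanSpace ℝ (Fin 3)) (u : ℝ → EuclideanSpace ℝ (Fin 3) → EuclideanSpace ℝ (Fin 3))
      (p : ℝ → EuclideanSpace ℝ (Fin 3) → ℝ), 0 < ν ∧ 0 < T ∧
      IsMaximalSmoothSolution ν 0 u p T ∧ HasRapidSpatialDecay (u 0) ∧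
      (∀ ρ ε : ℝ, 0 < ε → ∃ t₁ : ℝ, 0 ≤ t₁ ∧ t₁ < T ∧ ∀ t ∈ Set.Ioo t₁ T, ∀ y : EuclideanSpace ℝ (Fin 3), ‖y‖ ≤ ρ → ‖(T - t) ^ (1 - β) • Literature.Analysis.FluidPDE.rodrigues e (α * Real.log (T - t)) (u t (x₀ + (T - t) ^ β • Literature.Analysis.FluidPDE.rodrigues e (-(α * Real.log (T - t))) (y - c))) - A y‖ < ε)

/-- Sanity (the regime is the rung's): the window-convergence clause of `LinearRotatingProfileNSBlowup` is, for `U := ⇑A`,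
literally the clause used by the route's realisation / transfer cruxes; recorded as the trivial specialisation map from a
general profile `U` that happens to be linear. -/
theorem linearRotatingProfileNSBlowup_of_profile
    (h : ∃ (β α : ℝ) (e c : EuclideanSpace ℝ (Fin 3)) (U : EuclideanSpace ℝ (Fin 3) → EuclideanSpace ℝ (Fin 3))
      (A : EuclideanSpace ℝ (Fin 3) →L[ℝ] EuclideanSpace ℝ (Fin 3)), (U = ⇑A) ∧
      (2 / 5 : ℝ) ≤ β ∧ β < 1 / 2 ∧ α ≠ 0 ∧ ‖e‖ = 1 ∧
      ∃ (ν T : ℝ) (x₀ : EuclideanSpace ℝ (Fin 3)) (u : ℝ → EuclideanSpace ℝ (Fin 3) → EuclideanSpace ℝ (Fin 3))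
        (p : ℝ → EuclideanSpace ℝ (Fin 3) → ℝ), 0 < ν ∧ 0 < T ∧
        IsMaximalSmoothSolution ν 0 u p T ∧ HasRapidSpatialDecay (u 0) ∧
        (∀ ρ ε : ℝ, 0 < ε → ∃ t₁ : ℝ, 0 ≤ t₁ ∧ t₁ < T ∧ ∀ t ∈ Set.Ioo t₁ T, ∀ y : EuclideanSpace ℝ (Fin 3), ‖y‖ ≤ ρ → ‖(T - t) ^ (1 - β) • Literature.Analysis.FluidPDE.rodrigues e (α * Real.log (T - t)) (u t (x₀ + (T - t) ^ β • Literature.Analysis.FluidPDE.rodrigues e (-(α * Real.log (T - t))) (y - c))) - U y‖ < ε)) :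
    LinearRotatingProfileNSBlowup := by
  obtain ⟨β, α, e, c, U, A, rfl, hb1, hb2, hα, he, ν, T, x₀, u, p, hν, hT, hsol, hdec, hconv⟩ := h
  exact ⟨β, α, e, c, A, hb1, hb2, hα, he, ν, T, x₀, u, p, hν, hT, hsol, hdec, hconv⟩

end Summit.NavierStokesRegularity.NavierStokesRegularity.Theorems
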